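/-
Origin: expansion seat `planner-pub-hodgecm-pv09-g4-0`, handover #5a 2026-08-18T07:27:32Z (`HOME/pub-hodgecm-pv09-g4/lean/Pv09g4/CompactDomain.lean`, md5 6feabfc2, 482 lines);
landed by the gen-7 packager in gate run 26 as `HodgeCM/PerL34/CompactDomain.lean` (import ^import Pv[0-9]+g[0-9]+\.→import HodgeCM.PerL34. ×1).
-/
/-
HodgeCM / PerL34 publication cell — seam S3 support (pub-hodgecm-pv09-g4, HANDOVER #5).
Imports: `Pv09g4.DiscreteFundamentalDomain` (HANDOVER #2) ↦ `HodgeCM.PerL34.DiscreteFundamentalDomain`.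
Complete proofs, no new axioms, nothing cited.
-/
import Summits.HodgeConjecture.HodgeCM.PerL34.DiscreteFundamentalDomain_2

/-!
# Compact fundamental domains with non-empty interior and null boundary

`DiscreteFundamentalDomain` / `CocompactFundamentalDomain` produce, for a discrete cocompact subgroup
`Γ ≤ G`, a measurable RELATIVELY compact set containing exactly one point of every orbit.  The
"compact fundamental domain" branch of the S3 end theorems (pv09-g3 `theta_ne_zero_haarCpt`,
`theta_ne_zero_local`, `theta_ne_zero_levels(_of_places)`, pv13's `theta_ne_zero_levels_adic_*` END
FORMS) asks instead for a set `𝓕` with `IsCompact 𝓕` and `(interior 𝓕).Nonempty`, while the unfolding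
node N31e (`RallisIP.N31e_holds`, pv09-g4 `N31e_haarDatum`) needs `IsFundamentalDomain Γ 𝓕 μ`
(Mathlib's a.e. notion).  This file supplies ONE set with all three properties, for every measure which
is finite on compact sets and left and right invariant (every Haar measure of a unimodular, e.g.
commutative, group):

* `isFundamentalDomain_of_exact_of_null` — a null enlargement of an exact fundamental domain is a
  fundamental domain (pure measure theory);
* `closure_dom_diff_subset` — for the `piece`/`dom` construction over finitely many OPEN local sets,
  `closure 𝓕₀ \ 𝓕₀ ⊆ ⋃ₙ frontier (A n)` (pure topology);
* `exists_nhds_null_frontier` — in a locally compact group every neighbourhood of `1` contains an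
  open relatively compact neighbourhood `W` with `μ (frontier W) = 0` (Urysohn function + at most
  countably many level sets of positive measure);
* `exists_compact_isFundamentalDomain_left` (`Γ` normal, e.g. `G` commutative) and
  `exists_compact_isFundamentalDomain_op` (right action, any `Γ`):
  `∃ 𝓕, IsCompact 𝓕 ∧ (interior 𝓕).Nonempty ∧ IsFundamentalDomain Γ 𝓕 μ ∧ μ (frontier 𝓕) = 0`‑type
  conclusions (precisely: `𝓕` closed, compact, non-empty interior, measurable, a fundamental domain,
  and `𝓕 = closure 𝓕₀` for an exact measurable fundamental domain `𝓕₀` with `μ (𝓕 \ 𝓕₀) = 0`).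
-/

set_option autoImplicit false

noncomputable section

open MeasureTheory Set Topology Filter Function
open scoped Pointwise ENNReal

namespace HodgeCM.PerL34.DiscreteFD

/-! ## §1 Null enlargements of exact fundamental domains -/

section NullEnlargement

variable {Γ : Type*} {X : Type*} [Group Γ] [MulAction Γ X] [MeasurableSpace X]

omit [MeasurableSpace X] in
/-- Exactness forbids `γ • 𝓕₀` (`γ ≠ 1`) to meet `𝓕₀`. -/
theorem disjoint_smul_of_existsUnique {𝓕₀ : Set X} (hex : ∀ x : X, ∃! γ : Γ, γ • x ∈ 𝓕₀)
    {γ : Γ} (hγ : γ ≠ 1) : Disjoint (γ • 𝓕₀) 𝓕₀ := by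
  refine Set.disjoint_left.2 fun z hz hz₀ => hγ ?_
  obtain ⟨y, hy, rfl⟩ := mem_smul_set.1 hz
  obtain ⟨δ, -, huniq⟩ := hex y
  have h1 : (1 : Γ) = δ := huniq 1 (show (1 : Γ) • y ∈ 𝓕₀ by rwa [one_smul])
  have h2 : γ = δ := huniq γ hz₀
  rw [h2, ← h1]

/-- **A null enlargement of an exact fundamental domain is a fundamental domain.**  If every orbit
meets `𝓕₀` exactly once, `𝓕₀ ⊆ 𝓕`, `𝓕` is null-measurable and `μ (𝓕 \ 𝓕₀) = 0`, then `𝓕` is a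
fundamental domain for the (measurable, `μ`-preserving) action. -/
theorem isFundamentalDomain_of_exact_of_null [MeasurableConstSMul Γ X] (μ : Measure X)
    [SMulInvariantMeasure Γ X μ] {𝓕₀ 𝓕 : Set X} (hex : ∀ x : X, ∃! γ : Γ, γ • x ∈ 𝓕₀)
    (hsub : 𝓕₀ ⊆ 𝓕) (h𝓕 : NullMeasurableSet 𝓕 μ) (hnull : μ (𝓕 \ 𝓕₀) = 0) :
    IsFundamentalDomain Γ 𝓕 μ := by
  refine IsFundamentalDomain.mk'' h𝓕 (Eventually.of_forall fun x => ?_) (fun γ hγ => ?_)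
    fun γ => (measurePreserving_smul γ μ).quasiMeasurePreserving
  · obtain ⟨γ, hγ, -⟩ := hex x
    exact ⟨γ, hsub hγ⟩
  · -- `γ • 𝓕 ∩ 𝓕 ⊆ γ • (𝓕 \ 𝓕₀) ∪ (𝓕 \ 𝓕₀)`
    have hsub' : γ • 𝓕 ∩ 𝓕 ⊆ γ • (𝓕 \ 𝓕₀) ∪ (𝓕 \ 𝓕₀) := by
      rintro z ⟨hz, hz'⟩
      obtain ⟨y, hy, rfl⟩ := mem_smul_set.1 hz
      by_cases hy₀ : y ∈ 𝓕₀
      · by_cases hz₀ : γ • y ∈ 𝓕₀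
        · exact absurd hz₀ (Set.disjoint_left.1 (disjoint_smul_of_existsUnique hex hγ)
            (smul_mem_smul_set hy₀))
        · exact Or.inr ⟨hz', hz₀⟩
      · exact Or.inl (smul_mem_smul_set ⟨hy, hy₀⟩)
    refine measure_mono_null hsub' (measure_union_null ?_ hnull)
    rw [measure_smul]
    exact hnull

end NullEnlargement

/-! ## §2 The boundary of the `piece` / `dom` construction over open local sets -/

section Boundary

variable {Γ : Type*} {X : Type*} [Group Γ] [MulAction Γ X] [TopologicalSpace X]
  [ContinuousConstSMul Γ X]

/-- A point of the closure of the `n`-th piece which is not in the domain lies on the frontier of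
`A n` (the saturation of the earlier local sets is OPEN and misses the piece). -/
theorem closure_piece_diff_dom_subset {A : ℕ → Set X} (hA : ∀ n, IsOpen (A n)) (n : ℕ) :
    closure (piece Γ A n) \ dom Γ A ⊆ frontier (A n) := by
  rintro y ⟨hyc, hyd⟩
  by_cases hyA : y ∈ A n
  · exfalso
    have hyT : y ∈ ⋃ (m : ℕ) (_ : m < n), ⋃ γ : Γ, γ • A m := by
      by_contra h
      exact hyd (mem_iUnion.2 ⟨n, hyA, h⟩)
    have hTo : IsOpen (⋃ (m : ℕ) (_ : m < n), ⋃ γ : Γ, γ • A m) :=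
      isOpen_iUnion fun m => isOpen_iUnion fun _ => isOpen_iUnion fun γ => (hA m).smul γ
    obtain ⟨z, hzT, hzp⟩ := mem_closure_iff.1 hyc _ hTo hyT
    exact hzp.2 hzT
  · exact ⟨closure_mono (piece_subset (Γ := Γ) A n) hyc, fun h => hyA (interior_subset h)⟩

/-- If only finitely many local sets are non-empty, `closure (dom Γ A) \ dom Γ A ⊆ ⋃ₙ frontier (A n)`.
-/
theorem closure_dom_diff_subset {A : ℕ → Set X} (hA : ∀ n, IsOpen (A n)) {N : ℕ}
    (hN : ∀ n, N ≤ n → A n = ∅) :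
    closure (dom Γ A) \ dom Γ A ⊆ ⋃ n, frontier (A n) := by
  classical
  have hdom : dom Γ A = ⋃ n ∈ Finset.range N, piece Γ A n := by
    apply Subset.antisymm
    · rintro y hy
      obtain ⟨n, hn⟩ := mem_iUnion.1 hy
      have hnN : n < N := by
        by_contra h
        have := piece_subset (Γ := Γ) A n hn
        rw [hN n (not_lt.1 h)] at this
        exact this
      exact mem_iUnion₂.2 ⟨n, Finset.mem_range.2 hnN, hn⟩
    · rintro y hy
      obtain ⟨n, -, hn⟩ := mem_iUnion₂.1 hy
      exact mem_iUnion.2 ⟨n, hn⟩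
  rintro y ⟨hyc, hyd⟩
  rw [hdom, Finset.closure_biUnion] at hyc
  obtain ⟨n, -, hn⟩ := mem_iUnion₂.1 hyc
  exact mem_iUnion.2 ⟨n, closure_piece_diff_dom_subset hA n ⟨hn, hyd⟩⟩

omit [ContinuousConstSMul Γ X] in
/-- The first local set lies in the interior of (the closure of) the domain. -/
theorem subset_interior_closure_dom {A : ℕ → Set X} (hA0 : IsOpen (A 0)) :
    A 0 ⊆ interior (closure (dom Γ A)) := by
  refine interior_maximal (fun y hy => subset_closure (mem_iUnion.2 ⟨0, hy, ?_⟩)) hA0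
  intro h
  obtain ⟨m, hm, -⟩ := mem_iUnion₂.1 h
  exact Nat.not_lt_zero m hm

end Boundary

/-! ## §3 Finite local families indexed by `ℕ` -/

section LocalFamily

variable {G : Type*}

/-- The local family indexed by `ℕ`: the translates attached to an enumeration of a finset, then `∅`. -/
def localFamily (t : Finset G) (V : G → Set G) (n : ℕ) : Set G :=
  if h : n < t.card then V ((t.equivFin.symm ⟨n, h⟩ : ↥t) : G) else ∅

/-- (Ported verbatim from the HodgeCMPerL package; no docstring in the source.) -/
theorem localFamily_of_lt (t : Finset G) (V : G → Set G) {n : ℕ} (h : n < t.card) :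
    localFamily t V n = V ((t.equivFin.symm ⟨n, h⟩ : ↥t) : G) := by
  simp [localFamily, h]

/-- (Ported verbatim from the HodgeCMPerL package; no docstring in the source.) -/
theorem localFamily_of_le (t : Finset G) (V : G → Set G) {n : ℕ} (h : t.card ≤ n) :
    localFamily t V n = ∅ := by
  simp [localFamily, not_lt.2 h]

/-- Every property of all `V x`, `x ∈ t`, which also holds for `∅`, holds for the local family. -/
theorem localFamily_induction (t : Finset G) (V : G → Set G) {p : Set G → Prop} (h0 : p ∅)
    (hV : ∀ x ∈ t, p (V x)) (n : ℕ) : p (localFamily t V n) := by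
  by_cases h : n < t.card
  · rw [localFamily_of_lt t V h]
    exact hV _ (t.equivFin.symm ⟨n, h⟩).2
  · rw [localFamily_of_le t V (not_lt.1 h)]
    exact h0

/-- (Ported verbatim from the HodgeCMPerL package; no docstring in the source.) -/
theorem exists_localFamily_eq (t : Finset G) (V : G → Set G) {x : G} (hx : x ∈ t) :
    ∃ n, localFamily t V n = V x := by
  obtain ⟨⟨n, hn⟩, hnx⟩ := t.equivFin.symm.surjective ⟨x, hx⟩
  refine ⟨n, ?_⟩
  rw [localFamily_of_lt t V hn, hnx]

/-- (Ported verbatim from the HodgeCMPerL package; no docstring in the source.) -/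
theorem localFamily_subset (t : Finset G) (V : G → Set G) (n : ℕ) :
    localFamily t V n ⊆ ⋃ x ∈ t, V x :=
  localFamily_induction t V (p := fun s => s ⊆ ⋃ x ∈ t, V x) (empty_subset _)
    (fun _ hx => subset_biUnion_of_mem (u := fun x => V x) hx) n

end LocalFamily

/-! ## §4 Neighbourhoods of `1` with null boundary -/

section Group

variable {G : Type*} [Group G] [TopologicalSpace G] [IsTopologicalGroup G] [LocallyCompactSpace G]
  [T2Space G] [MeasurableSpace G] [BorelSpace G]

/-- **Null-boundary neighbourhoods.**  Every neighbourhood `U` of `1` contains an open relatively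
compact neighbourhood `W` of `1` with `μ (frontier W) = 0` (for `μ` finite on compact sets): take a
Urysohn function `f` supported in a relatively compact part of `U` with `f 1 = 1`; its level sets
`{f = r}`, `0 < r < 1`, are disjoint, so at most countably many have positive measure, and
`W = {r < f}` for any other `r` works (`frontier {r < f} ⊆ {f = r}`). -/
theorem exists_nhds_null_frontier (μ : Measure G) [IsFiniteMeasureOnCompacts μ] {U : Set G}
    (hU : U ∈ 𝓝 (1 : G)) :
    ∃ W : Set G, IsOpen W ∧ (1 : G) ∈ W ∧ W ⊆ U ∧ IsCompact (closure W) ∧ μ (frontier W) = 0 := by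
  obtain ⟨C, hC, hCU, hCc⟩ := local_compact_nhds hU
  set V : Set G := interior C with hV
  have hVo : IsOpen V := isOpen_interior
  have h1V : (1 : G) ∈ V := mem_interior_iff_mem_nhds.2 hC
  have hVcp : IsCompact (closure V) := hCc.closure_of_subset interior_subset
  obtain ⟨f, hfs, hf1, hf01⟩ := exists_tsupport_one_of_isOpen_isClosed hVo hVcp isClosed_singleton
    (singleton_subset_iff.2 h1V)
  have hf1' : f 1 = 1 := by simpa using hf1 (mem_singleton (1 : G))
  -- the level sets of positive measure are countable
  set S : ↥(Ioo (0 : ℝ) 1) → Set G := fun r => {x | f x = (r : ℝ)} with hS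
  have hSm : ∀ r, MeasurableSet (S r) := fun r =>
    (isClosed_eq f.continuous continuous_const).measurableSet
  have hSd : Pairwise (Disjoint on S) := by
    intro r r' hrr'
    refine Set.disjoint_left.2 fun x hx hx' => hrr' (Subtype.ext ?_)
    rw [← show f x = (r : ℝ) from hx, ← show f x = (r' : ℝ) from hx']
  have hSU : (⋃ r, S r) ⊆ closure V := by
    rintro x hx
    obtain ⟨r, hr⟩ := mem_iUnion.1 hx
    have hx0 : f x ≠ 0 := by
      rw [show f x = (r : ℝ) from hr]
      exact ne_of_gt r.2.1
    exact subset_closure (hfs (subset_tsupport _ hx0))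
  have hSfin : μ (⋃ r, S r) ≠ ∞ :=
    ((measure_mono hSU).trans_lt hVcp.measure_lt_top).ne
  have hcount := Measure.countable_meas_pos_of_disjoint_of_meas_iUnion_ne_top μ hSm hSd hSfin
  -- some `r ∈ (0,1)` has a null level set
  obtain ⟨r, hr⟩ : ∃ r : ↥(Ioo (0 : ℝ) 1), μ (S r) = 0 := by
    by_contra hall
    have huniv : (univ : Set ↥(Ioo (0 : ℝ) 1)) ⊆ {r | 0 < μ (S r)} := fun r _ =>
      pos_iff_ne_zero.2 fun h => hall ⟨r, h⟩
    have hc : (univ : Set ↥(Ioo (0 : ℝ) 1)).Countable := hcount.mono huniv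
    have hc' : (Ioo (0 : ℝ) 1).Countable := by
      have := hc.image ((↑) : ↥(Ioo (0 : ℝ) 1) → ℝ)
      rwa [image_univ, Subtype.range_coe] at this
    have h0 : volume (Ioo (0 : ℝ) 1) = 0 := hc'.measure_zero volume
    rw [Real.volume_Ioo] at h0
    norm_num at h0
  refine ⟨{x | (r : ℝ) < f x}, isOpen_lt continuous_const f.continuous, ?_, ?_, ?_, ?_⟩
  · show (r : ℝ) < f 1
    rw [hf1']
    exact r.2.2
  · intro x hx
    have hx0 : f x ≠ 0 := (r.2.1.trans hx).ne'
    exact hCU (interior_subset (hfs (subset_tsupport _ hx0)))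
  · refine hVcp.of_isClosed_subset isClosed_closure (closure_mono fun x hx => ?_)
    have hx0 : f x ≠ 0 := (r.2.1.trans hx).ne'
    exact hfs (subset_tsupport _ hx0)
  · refine measure_mono_null ?_ hr
    intro x hx
    have := frontier_lt_subset_eq continuous_const f.continuous hx
    exact (this : (r : ℝ) = f x).symm

/-- A null-boundary, relatively compact, open neighbourhood `W` of `1` with `W W⁻¹ ⊆ U` and
`W⁻¹ W ⊆ U`. -/
theorem exists_good_nhds (μ : Measure G) [IsFiniteMeasureOnCompacts μ] {U : Set G}
    (hU : U ∈ 𝓝 (1 : G)) :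
    ∃ W : Set G, IsOpen W ∧ (1 : G) ∈ W ∧ (∀ a ∈ W, ∀ b ∈ W, a * b⁻¹ ∈ U) ∧
      (∀ a ∈ W, ∀ b ∈ W, a⁻¹ * b ∈ U) ∧ IsCompact (closure W) ∧ μ (frontier W) = 0 := by
  obtain ⟨W₀, hW₀o, hW₀1, hr, hl⟩ := exists_open_symm_nhds hU
  obtain ⟨W, hWo, hW1, hWW₀, hWc, hWf⟩ := exists_nhds_null_frontier μ (hW₀o.mem_nhds hW₀1)
  exact ⟨W, hWo, hW1, fun a ha b hb => hr a (hWW₀ ha) b (hWW₀ hb),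
    fun a ha b hb => hl a (hWW₀ ha) b (hWW₀ hb), hWc, hWf⟩

/-! ## §5 Local sets from a fixed neighbourhood, finite covers -/

omit [TopologicalSpace G] [IsTopologicalGroup G] [LocallyCompactSpace G] [T2Space G]
  [MeasurableSpace G] [BorelSpace G] in
/-- Separation of the right translates `W x` under the LEFT action of `Γ`. -/
theorem disjoint_smul_translate_left {Γ : Subgroup G} {U W : Set G}
    (hU1 : ∀ γ : Γ, (γ : G) ∈ U → γ = 1) (hWr : ∀ a ∈ W, ∀ b ∈ W, a * b⁻¹ ∈ U) (x : G)
    (γ : Γ) (hγ : γ ≠ 1) : Disjoint (γ • ((fun w => w * x) '' W)) ((fun w => w * x) '' W) := by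
  refine Set.disjoint_left.2 ?_
  rintro z hz ⟨b, hb, rfl⟩
  obtain ⟨y, ⟨a, ha, rfl⟩, hy⟩ := mem_smul_set.1 hz
  apply hγ
  apply hU1
  rw [Subgroup.smul_def, smul_eq_mul] at hy
  have : (γ : G) = b * a⁻¹ := by
    calc (γ : G) = (γ : G) * (a * x) * (a * x)⁻¹ := by group
    _ = b * a⁻¹ := by rw [hy]; group
  rw [this]
  exact hWr b hb a ha

omit [TopologicalSpace G] [IsTopologicalGroup G] [LocallyCompactSpace G] [T2Space G]
  [MeasurableSpace G] [BorelSpace G] in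
/-- Separation of the left translates `x W` under the RIGHT action (`Γ.op`). -/
theorem disjoint_smul_translate_op {Γ : Subgroup G} {U W : Set G}
    (hU1 : ∀ γ : Γ, (γ : G) ∈ U → γ = 1) (hWl : ∀ a ∈ W, ∀ b ∈ W, a⁻¹ * b ∈ U) (x : G)
    (γ : Γ.op) (hγ : γ ≠ 1) : Disjoint (γ • ((fun w => x * w) '' W)) ((fun w => x * w) '' W) := by
  refine Set.disjoint_left.2 ?_
  rintro z hz ⟨b, hb, rfl⟩
  obtain ⟨y, ⟨a, ha, rfl⟩, hy⟩ := mem_smul_set.1 hz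
  have hmem : MulOpposite.unop (γ : Gᵐᵒᵖ) ∈ Γ := Subgroup.mem_op.1 γ.2
  apply hγ
  rw [Subgroup.smul_def, MulOpposite.smul_eq_mul_unop] at hy
  have hval : MulOpposite.unop (γ : Gᵐᵒᵖ) = a⁻¹ * b := by
    calc MulOpposite.unop (γ : Gᵐᵒᵖ)
        = (x * a)⁻¹ * ((x * a) * MulOpposite.unop (γ : Gᵐᵒᵖ)) := by group
    _ = a⁻¹ * b := by rw [hy]; group
  have h1 : (⟨MulOpposite.unop (γ : Gᵐᵒᵖ), hmem⟩ : Γ) = 1 := by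
    apply hU1
    show MulOpposite.unop (γ : Gᵐᵒᵖ) ∈ U
    rw [hval]
    exact hWl a ha b hb
  have h2 : MulOpposite.unop (γ : Gᵐᵒᵖ) = 1 := congrArg Subtype.val h1
  exact Subtype.ext ((MulOpposite.unop_eq_one_iff _).1 h2)

omit [T2Space G] [MeasurableSpace G] [BorelSpace G] in
/-- Cocompactness: finitely many left translates `x W` meet every right `Γ`-orbit. -/
theorem exists_finset_cover_op (Γ : Subgroup G) [CompactSpace (G ⧸ Γ)] {W : Set G}
    (hWo : IsOpen W) (hW1 : (1 : G) ∈ W) :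
    ∃ t : Finset G, ∀ y : G, ∃ γ : Γ.op, ∃ x ∈ t, γ • y ∈ (fun w => x * w) '' W := by
  obtain ⟨K, hKc, -, hK⟩ := exists_isCompact_cover_op Γ
  obtain ⟨t, ht⟩ := hKc.elim_finite_subcover (fun x : G => (fun w => x * w) '' W)
    (fun x => isOpenMap_mul_left x W hWo) fun x hx => mem_iUnion.2 ⟨x, 1, hW1, mul_one x⟩
  refine ⟨t, fun y => ?_⟩
  obtain ⟨γ, hγ⟩ := hK y
  obtain ⟨x, hx, hx'⟩ := mem_iUnion₂.1 (ht hγ)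
  exact ⟨γ, x, hx, hx'⟩

omit [T2Space G] [MeasurableSpace G] [BorelSpace G] in
/-- Cocompactness, `Γ` normal: finitely many right translates `W x` meet every left `Γ`-orbit. -/
theorem exists_finset_cover_left (Γ : Subgroup G) [Γ.Normal] [CompactSpace (G ⧸ Γ)] {W : Set G}
    (hWo : IsOpen W) (hW1 : (1 : G) ∈ W) :
    ∃ t : Finset G, ∀ y : G, ∃ γ : Γ, ∃ x ∈ t, γ • y ∈ (fun w => w * x) '' W := by
  obtain ⟨K, hKc, -, hK⟩ := exists_isCompact_cover_left Γ
  obtain ⟨t, ht⟩ := hKc.elim_finite_subcover (fun x : G => (fun w => w * x) '' W)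
    (fun x => isOpenMap_mul_right x W hWo) fun x hx => mem_iUnion.2 ⟨x, 1, hW1, one_mul x⟩
  refine ⟨t, fun y => ?_⟩
  obtain ⟨γ, hγ⟩ := hK y
  obtain ⟨x, hx, hx'⟩ := mem_iUnion₂.1 (ht hγ)
  exact ⟨γ, x, hx, hx'⟩

/-! ## §6 Compact fundamental domains with non-empty interior -/


-- port_pkg: scope closed for this part
end Group
end HodgeCM.PerL34.DiscreteFD
end
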